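import Summits.ABC.ABC.Theses.DefiniteXi
import Summits.ABC.ABC.Theorems.DefiniteXiDefiniteRTControlPrime
import Summits.ABC.ABC.Theorems.IsogenyGlueCongruenceKenkuPrintedLevelsOfThreeLevels
import Summits.ABC.ABC.Theorems.IsogenyGlueCongruenceMazurKenkuBoundOfRadius
import Summits.ABC.ABC.Theorems.KenkuLevelTwentySixRankZero
import Summits.ABC.ABC.Theorems.IsogenyGlueCongruenceKenkuLevelFortyNine
import Summits.ABC.ABC.Theorems.IsogenyGlueCongruenceMazurKenkuBoundLevelThirtyTwo
import Summits.ABC.ABC.Theorems.IsogenyGlueCongruenceMazurKenkuBoundLevelTwenty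
import Literature.NumberTheory.EllipticCurves.ManinConstantArbitraryParametrizationIntegralProofs
import Literature.NumberTheory.EllipticCurves.PastenSpectralDegreeIsogenyBoundProofs
import Literature.NumberTheory.EllipticCurves.KleinFrickeLevelTwentySeven
import Literature.NumberTheory.EllipticCurves.KleinFrickeLevelThirteen
import Literature.NumberTheory.EllipticCurves.RationalTwoTorsionModPIrreducibleProofs
import Literature.NumberTheory.EllipticCurves.MazurTorsionPrimeCaseFromCor44Proofs
import Literature.NumberTheory.EllipticCurves.Rank1Residual.GVParityTwistTransportProofs
import HarnessLib

/-!
# Stub-ideation k=1 (gen 5) for `stub_pasten163` — crux `DefiniteRTControlPrime`, route DefiniteXi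

HOME FAMILY 1 — RECOGNISE & IMPORT. Scratch check (elaboration only; `sorry` only inside helper
bodies marked S/M) of the helper statements of `STUB-IDEAS-stub_pasten163-1.md` (gen 5).

**Recognition (Plan A).** The stub's statement `PastenShimura2024_minimalDegree_le_163_mul` is,
definitionally, the crux `IsogenyGlueCongruence.MazurKenkuBound` (stmt-ABC-15125), and is ONE LINE
from the named fact `mazurKenku_exists_cyclic_isogeny` by the landed
`PastenShimura2024_minimalDegree_le_163_mul_of_mazurKenku'` (Edixhoven/Stevens integrality now a
theorem: `int_of_smul_periodLattice_le_all`). Best landed trust base of the verbatim stub: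
`mazurKenkuBound_of_cor44_of_kleinFricke13_of_primeTables_of_threeLevels`
= {Mazur Cor. 4.4 (stmt-ABC-18223), Klein–Fricke 13 (cite-only), seven prime `j`-tables, levels
`65, 125, 169`} — no cheaper import exists: verbatim, the stub is `blocked-on: stmt-ABC-15125`.

**Plan A′ (gen 5) — the FREY INSTANCE, which is all the skeleton uses.** `Lines/Sketch.lean` and the
landed `definiteRTControlPrime_of_facts` instantiate `h163` ONCE, at
`(N, W₀, C • freyCurve a b, D₀, D₁)` with an odd prime `q ∣ N` in hand. New in gen 5:
* H1 is now a POINTWISE copy of two LITERATURE proof bodies (`…_le_163_mul_of`,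
  `…_le_163_mul_of_mazurKenku`) with `163 ↦ B`, Mazur–Kenku ↦ a class-local isogeny radius, and
  `hInt` discharged by `int_of_smul_periodLattice_le_all` — no semistability, no Edixhoven item
  (§1, PROVED here by the copy);
* the level-`27` input `hT27` of gen 4 is the landed `Isogeny.j_eq_of_isCyclic_degree_twentySeven`
  (p171877), so the Frey cyclic diameter `d ∣ 1008` needs only {Cor. 4.4, Klein–Fricke 13} (§3);
* composition through the landed closer's own proof (§2: one line changed), so the crux holds
  modulo {Takahashi 2.3, Cor. 4.4, Klein–Fricke 13, Lemma 6.8} — and modulo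
  {Takahashi 2.3, Cor. 4.4, Klein–Fricke 13} with k3g4's Lemma-6.8-free two-facts composition.
-/

-- `Summit.ABC.ABC` is the mandated summit-side namespace; the duplicate is deliberate.
set_option linter.dupNamespace false
set_option linter.unusedSimpArgs false

noncomputable section

open scoped MatrixGroups ModularForm
open CongruenceSubgroup UpperHalfPlane

namespace Summit.ABC.ABC.Cruxes.DefiniteRTControlPrime.Sketch.Ideas1g5

open Summit.ABC.ABC.Theses.DefiniteXi
open Literature.NumberTheory.EllipticCurves Literature.NumberTheory.EllipticCurves.ModularForms
open Literature.NumberTheory.Automorphic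
open Literature.NumberTheory.GaloisRepresentations
open WeierstrassCurve IsDedekindDomain NumberField Field

/-! ## §0 Recognition — the stub verbatim -/

/-- The stub IS the sibling crux `MazurKenkuBound` (stmt-ABC-15125), definitionally. -/
example : PastenShimura2024_minimalDegree_le_163_mul ↔
    Summit.ABC.ABC.Theses.IsogenyGlueCongruence.MazurKenkuBound := Iff.rfl

/-- Plan A, closer 1 (XS, landed): the stub from the Mazur–Kenku named fact ALONE.
[cite: PastenShimura2024, §3 p. 13] [cite: Mazur1978, Thm. 1] [cite: Kenku1982] -/
theorem stub_pasten163_of_mazurKenku (hMK : mazurKenku_exists_cyclic_isogeny) :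
    PastenShimura2024_minimalDegree_le_163_mul :=
  PastenShimura2024_minimalDegree_le_163_mul_of_mazurKenku' hMK

/-- Plan A, closer 2 (XS, landed): the verbatim stub on its smallest landed trust base.
[cite: Mazur1978, Cor. 4.4] [cite: Kenku1982, proof of Thm. 1, p. 200] -/
theorem stub_pasten163_of_threeLevels
    (h44 : Summit.ABC.ABC.Theses.IsogenyGlueCongruence.MazurCor44)
    (h13 : kleinFrickeThirteen_exists_j_eq)
    (hT7 : ∀ (V V' : WeierstrassCurve ℚ) [V.IsElliptic] [V'.IsElliptic] (ψ : Isogeny V V'),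
      ψ.IsCyclic → ψ.degree ∈ ({11, 17, 19, 37, 43, 67, 163} : Finset ℕ) →
        (ψ.degree, V.j) ∈ ({((11 : ℕ), (-32768 : ℚ)), (11, -121), (11, -24729001),
          (17, -297756989 / 2), (17, -882216989 / 131072), (19, -884736), (37, -9317),
          (37, -162677523113838677), (43, -884736000), (67, -147197952000),
          (163, -262537412640768000)} : Finset (ℕ × ℚ)))
    (hL3 : ∀ (V V' : WeierstrassCurve ℚ) [V.IsElliptic] [V'.IsElliptic] (ψ : Isogeny V V'),
      ψ.IsCyclic → ψ.degree ∉ ({65, 125, 169} : Finset ℕ)) :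
    PastenShimura2024_minimalDegree_le_163_mul :=
  Summit.ABC.ABC.Theorems.mazurKenkuBound_of_cor44_of_kleinFricke13_of_primeTables_of_threeLevels
    h44 h13 hT7 hL3

/-! ## §1 H1 — Pasten's sentence POINTWISE, with a class-local radius `B` (copies of tree proofs) -/

/-- **H1a** (S; PROVED — verbatim the body of the landed `PastenShimura2024_minimalDegree_le_163_mul_of`
with `163 ↦ B`, used at ONE `(W', D')`): an admissible integer multiplier `k` with `#ker(z ↦ kz) ≤ B`
gives `deg φ_{D'} ≤ B · deg φ_D` for a minimal datum `D'` of `W'`. Global minimality of `W'` is not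
used here. [cite: PastenShimura2024, §3 p. 13] -/
theorem modularDegree_le_mul_of_intKer (B : ℕ) {N : ℕ} [NeZero N] {W W' : WeierstrassCurve ℚ}
    [W.IsElliptic] [W'.IsElliptic] (D : ModularParametrizationData W N)
    (D' : ModularParametrizationData W' N) (hf : D'.f = D.f)
    (hmin' : ∀ D'' : ModularParametrizationData W' N, D'.modularDegree ≤ D''.modularDegree)
    (hB : ∃ (k : ℤ) (hk : ∀ z ∈ periodLattice D'.f, (k : ℂ) * z ∈ D'.L.lattice), k ≠ 0 ∧
        Nat.card (mulQuotientMap (periodLattice D'.f) D'.L.lattice.toAddSubgroup (k : ℂ) hk).ker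
          ≤ B) :
    D'.modularDegree ≤ B * D.modularDegree := by
  haveI := discreteTopology_periodLattice_of_mul_mem D'.f D'.cast_c_ne_zero
    D'.smul_periodLattice_le
  obtain ⟨δ, hδ, hfinδ⟩ := exists_degree_eichlerShimuraMap' (N := N) D'.isNewformOf.1.ne_zero
  have hδD : δ ≤ D.modularDegree := D.degree_eichlerShimuraMap_le_modularDegree hf.symm hδ hfinδ
  obtain ⟨k, hk, hk0, hkB⟩ := hB
  obtain ⟨d, hd, hfin⟩ := exists_modularDegree_holds D'.isNewformOf.1.ne_zero (L := D'.L)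
    (c := (k : ℂ)) (Int.cast_ne_zero.mpr hk0) hk
  have he : ∀ x : ℂ, D'.torusEquiv.toEquiv (x : ℂ ⧸ D'.L.lattice.toAddSubgroup) = D'.uniformize x :=
    fun _ ↦ rfl
  have key := (finite_setOf_card_fiberOrbits_ne_iff D'.torusEquiv.toEquiv
    (fun τ : ℍ ↦ (((k : ℂ) * eichlerIntegral D'.f τ : ℂ) : ℂ ⧸ D'.L.lattice.toAddSubgroup)) d).mpr
    hfin
  simp only [he] at key
  let Dk : ModularParametrizationData W' N :=
    { D' with
      c := k
      smul_periodLattice_le := hk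
      deg := d
      deg_pos := hd
      deg_spec := key }
  obtain ⟨hfinK, hdegK⟩ := Dk.modularDegree_eq_card_ker_mul_of_eichlerShimuraMap rfl hδ hfinδ
  have hkerK : Nat.card Dk.isogenyMap.ker ≤ B := hkB
  calc D'.modularDegree ≤ Dk.modularDegree := hmin' Dk
    _ = Nat.card Dk.isogenyMap.ker * δ := hdegK
    _ ≤ B * δ := Nat.mul_le_mul_right δ hkerK
    _ ≤ B * D.modularDegree := Nat.mul_le_mul_left B hδD

/-- **H1b** (S; PROVED — verbatim the body of the landed `PastenShimura2024_minimalDegree_le_163_mul_of_mazurKenku`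
with the Mazur–Kenku fact replaced by a radius `B` on the class OF THIS `W'` and `hInt` by the landed
`int_of_smul_periodLattice_le_all`): for a globally minimal `W'` with a datum `D'`, an isogeny of degree
`≤ B` between the short models of `E_f` and `W'` yields an admissible INTEGER multiplier with `#ker ≤ B`.
[cite: PastenShimura2024, §3 p. 13] [cite: Stevens1989, §1 Thm. 1.3] [cite: EdixhovenManin1991, Prop. 2] -/
theorem exists_intKer_le_of_classRadius (B : ℕ) {N : ℕ} [NeZero N] {W' : WeierstrassCurve ℚ}
    [W'.IsElliptic] [W'.IsGloballyMinimal] (D' : ModularParametrizationData W' N)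
    (hRad : ∀ (W₁ W₂ : WeierstrassCurve ℚ) [W₁.IsElliptic] [W₂.IsElliptic],
      IsIsogenous W₁ W' → IsIsogenous W₁ W₂ → ∃ ψ : Isogeny W₁ W₂, ψ.degree ≤ B) :
    ∃ (k : ℤ) (hk : ∀ z ∈ periodLattice D'.f, (k : ℂ) * z ∈ D'.L.lattice), k ≠ 0 ∧
      Nat.card (mulQuotientMap (periodLattice D'.f) D'.L.lattice.toAddSubgroup (k : ℂ) hk).ker
        ≤ B := by
  -- the `ℚ`-model `W₀ = E_f` of `ℂ/Λ_f`, with Néron-type lattice exactly `Λ_f`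
  obtain ⟨W₀, hW₀, -, L₀, hL₀, hΛ⟩ := D'.exists_latticeEq_model
  haveI := hW₀
  have hmem : ∀ z, z ∈ L₀.lattice ↔ z ∈ periodLattice D'.f := fun z ↦ by
    rw [← SetLike.mem_coe, hΛ, SetLike.mem_coe]
  -- `W₀ ~ W'` over `ℚ`, along `z ↦ c' z`
  have hc : (D'.c : ℚ) ≠ 0 := by exact_mod_cast D'.maninConstant_ne_zero_holds
  have hle : ∀ z ∈ L₀.lattice, ((D'.c : ℚ) : ℂ) * z ∈ D'.L.lattice := fun z hz ↦ by
    rw [Rat.cast_intCast]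
    exact D'.smul_periodLattice_le z ((hmem z).mp hz)
  have hiso : IsIsogenous W₀ W' :=
    isIsogenous_of_forall_mul_mem_lattice hL₀.1 hL₀.2 D'.isNeronLattice.1 D'.isNeronLattice.2 hc hle
  -- the short models are `E_{Λ_f}`, `E_{Λ_{E'}}` after base change, and are `ℚ`-isogenous
  set C₀ : VariableChange ℚ := ⟨1, -W₀.b₂ / 12, -W₀.a₁ / 2, W₀.a₁ * W₀.b₂ / 24 - W₀.a₃ / 2⟩
    with hC₀
  set C' : VariableChange ℚ := ⟨1, -W'.b₂ / 12, -W'.a₁ / 2, W'.a₁ * W'.b₂ / 24 - W'.a₃ / 2⟩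
    with hC'
  have hE₀ : (C₀ • W₀).baseChange ℂ = L₀.curve := shortModel_baseChange_eq_curve W₀ hL₀
  have hE' : (C' • W').baseChange ℂ = D'.L.curve := shortModel_baseChange_eq_curve W' D'.isNeronLattice
  have h₁ : IsIsogenous (C₀ • W₀) W' := (isIsogenous_of_smul W₀ C₀).trans' hiso
  have h : IsIsogenous (C₀ • W₀) (C' • W') := h₁.trans' (isIsogenous_smul W' C')
  -- the class-local radius: a `ℚ`-isogeny `ψ` of degree `≤ B`
  obtain ⟨ψ, hB⟩ := hRad (C₀ • W₀) (C' • W') h₁ h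
  -- its rational multiplier `q`: `qΛ_f ⊆ Λ_{E'}`, `#ker(z ↦ qz) = deg ψ`
  obtain ⟨q, hq0, hq, hdegq⟩ :=
    degree_eq_natCard_ker_mulQuotientMap_of_baseChange_eq_curve ψ hE₀ hE'
  have hq' : ∀ z ∈ periodLattice D'.f, (q : ℂ) * z ∈ D'.L.lattice := fun z hz ↦
    hq z ((hmem z).mpr hz)
  -- `q = k ∈ ℤ` (Stevens-strength integrality, landed)
  obtain ⟨k, rfl⟩ := int_of_smul_periodLattice_le_all D' q hq'
  have hk : ∀ z ∈ periodLattice D'.f, (k : ℂ) * z ∈ D'.L.lattice := fun z hz ↦ by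
    have := hq' z hz
    rwa [Rat.cast_intCast] at this
  refine ⟨k, hk, by exact_mod_cast hq0, ?_⟩
  have hΛ' : L₀.lattice.toAddSubgroup = periodLattice D'.f :=
    SetLike.coe_injective (by rw [Submodule.coe_toAddSubgroup, hΛ])
  have hcast : ((k : ℚ) : ℂ) = (k : ℂ) := Rat.cast_intCast k
  calc Nat.card (mulQuotientMap (periodLattice D'.f) D'.L.lattice.toAddSubgroup (k : ℂ) hk).ker
      = Nat.card (mulQuotientMap L₀.lattice.toAddSubgroup D'.L.lattice.toAddSubgroup
          ((k : ℚ) : ℂ) hq).ker := by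
        simp only [hcast]
        exact (natCard_ker_mulQuotientMap_congr hΛ' rfl (fun z hz ↦ hk z (hΛ' ▸ hz)) hk).symm
    _ = ψ.degree := hdegq.symm
    _ ≤ B := hB

/-- **H1** (XS, PROVED: H1a ∘ H1b): Pasten's `163`-sentence with `163 ↦ B`, for ONE globally minimal
`W'` whose isogeny class has radius `≤ B`. [cite: PastenShimura2024, §3 p. 13] -/
theorem modularDegree_le_mul_of_classRadius (B : ℕ) {N : ℕ} [NeZero N] {W W' : WeierstrassCurve ℚ}
    [W.IsElliptic] [W'.IsElliptic] [W'.IsGloballyMinimal] (D : ModularParametrizationData W N)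
    (D' : ModularParametrizationData W' N) (hf : D'.f = D.f)
    (hmin' : ∀ D'' : ModularParametrizationData W' N, D'.modularDegree ≤ D''.modularDegree)
    (hRad : ∀ (W₁ W₂ : WeierstrassCurve ℚ) [W₁.IsElliptic] [W₂.IsElliptic],
      IsIsogenous W₁ W' → IsIsogenous W₁ W₂ → ∃ ψ : Isogeny W₁ W₂, ψ.degree ≤ B) :
    D'.modularDegree ≤ B * D.modularDegree :=
  modularDegree_le_mul_of_intKer B D D' hf hmin' (exists_intKer_le_of_classRadius B D' hRad)

/-! ## §2 The Frey instance of the stub and the composition -/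

/-- **`PastenBoundFrey B`** — the only instances of the stub the skeleton uses: the `163`-sentence with
constant `B` for globally minimal `W'` in the class of a Frey curve having an ODD bad prime `q`
(class-minimality of `D` is not needed). `PastenBoundFrey 163` ⟸ the stub (trivially). -/
def PastenBoundFrey (B : ℕ) : Prop :=
  ∀ a b : ℤ, IsCoprime a b → a * b * (a + b) ≠ 0 →
    ∀ q : ℕ, q.Prime → q ≠ 2 → q ∣ (freyCurve a b).conductorNorm ℤ →
      ∀ (N : ℕ) [NeZero N] (W W' : WeierstrassCurve ℚ) [W.IsElliptic] [W'.IsElliptic]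
        [W'.IsGloballyMinimal] (D : ModularParametrizationData W N)
        (D' : ModularParametrizationData W' N),
        (freyCurve a b).IsIsogenous W' → D'.f = D.f →
          (∀ D'' : ModularParametrizationData W' N, D'.modularDegree ≤ D''.modularDegree) →
            D'.modularDegree ≤ B * D.modularDegree

/-- (XS, proved) the stub gives `PastenBoundFrey 163` — so every plan below is a weakening. -/
theorem pastenBoundFrey_of_stub (h163 : PastenShimura2024_minimalDegree_le_163_mul) :
    PastenBoundFrey 163 :=
  fun _ _ _ _ _ _ _ _ N _ W W' _ _ _ D D' _ hf hmin' ↦ by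
    -- the lattice-optimal datum `D₀` of the class has minimal degree; compare through it
    obtain ⟨W₀, hW₀, D₀, hf₀, h₀⟩ := D.exists_optimalDatum'
    haveI := hW₀
    have hker₀ : D₀.isogenyMap.ker = ⊥ := D₀.isogenyMap_ker_eq_bot_iff.mpr h₀
    have hmin₀ : ∀ (W'' : WeierstrassCurve ℚ) [W''.IsElliptic]
        (D'' : ModularParametrizationData W'' N), D''.f = D₀.f →
          D₀.modularDegree ≤ D''.modularDegree := fun W'' _ D'' hD'' =>
      D₀.modularDegree_le_of_isogenyMap_ker_eq_bot hker₀ D'' hD''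
    calc D'.modularDegree ≤ 163 * D₀.modularDegree :=
          h163 N W₀ W' D₀ D' (hf.trans hf₀.symm) hmin₀ hmin'
      _ ≤ 163 * D.modularDegree := Nat.mul_le_mul_left _ (hmin₀ W D hf₀.symm)

/-- The ODD-prime-restricted, CONSTANT Frey cyclic diameter (gen 4's `FreyIsogenyDiameterOdd`,
re-declared: crux-dir modules are not importable). -/
def FreyIsogenyDiameterOdd (B : ℕ) : Prop :=
  ∀ a b : ℤ, IsCoprime a b → a * b * (a + b) ≠ 0 →
    ∀ q : ℕ, q.Prime → q ≠ 2 → q ∣ (freyCurve a b).conductorNorm ℤ →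
      ∀ (W₁ W₂ : WeierstrassCurve ℚ) [W₁.IsElliptic] [W₂.IsElliptic],
        (freyCurve a b).IsIsogenous W₁ → ∀ φ : Isogeny W₁ W₂, φ.IsCyclic → φ.degree ≤ B

/-- **L1** (XS, PROVED): a cyclic diameter `B` on the Frey class gives `PastenBoundFrey B` — the class
radius at `W'` is `≤ B` through a CYCLIC isogeny (`IsIsogenous.exists_isCyclic`), then H1.
[cite: PastenShimura2024, §3 p. 13] [cite: SilvermanAEC2009, Cor. III.4.11] -/
theorem pastenBoundFrey_of_diameter {B : ℕ} (hDiam : FreyIsogenyDiameterOdd B) :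
    PastenBoundFrey B := by
  intro a b hab h0 q hq hq2 hqN N _ W W' _ _ _ D D' hE hf hmin'
  refine modularDegree_le_mul_of_classRadius B D D' hf hmin' fun W₁ W₂ _ _ h₁ h₁₂ ↦ ?_
  obtain ⟨ψ, hψ⟩ := h₁₂.exists_isCyclic
  exact ⟨ψ, hDiam a b hab h0 q hq hq2 hqN W₁ W₂ (hE.trans' h₁.symm_of_charZero) ψ hψ⟩

/-- **L2** (S; PROVED — the landed `definiteRTControlPrime_of_facts` VERBATIM with its single use of
`h163` replaced by `hB a b … (isIsogenous_smul (freyCurve a b) C) …` and the constant `4·163² ↦ 4·B·163`):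
the crux from {Takahashi 2.3, `PastenBoundFrey B`, Lemma 6.8}. [cite: Takahashi2001, Thm. 2.3]
[cite: PastenShimura2024, §3 p. 13 and Lemma 6.8 (p. 22)] -/
theorem definiteRTControlPrime_of_pastenBoundFrey (hT : takahashi2001_thm_2_3_of_coprime) {B : ℕ}
    (hB : PastenBoundFrey B) (h68 : PastenShimura2024_lemma_6_8) : DefiniteRTControlPrime := by
  intro ε hε
  refine ⟨((4 * B * 163 : ℕ) : ℝ), ?_⟩
  intro a b hab h0 N _ hN q hq hq2 hqN D hDmin
  obtain ⟨M, hM⟩ := hqN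
  rw [mul_comm] at hM
  subst hM
  haveI := isElliptic_freyCurve h0
  have hdiv : M * q / q = M := Nat.mul_div_cancel M hq.pos
  rw [hdiv]
  have hqN' : q ∣ (freyCurve a b).conductorNorm ℤ := by rw [hN]; exact Dvd.intro_left M rfl
  have hcop : M.Coprime q := by
    have h := Summit.ABC.ABC.Theorems.DefiniteRTControlPrime.stub_freyLocal a b hab h0 q hq hq2 hqN'
    rwa [hN, hdiv] at h
  obtain ⟨C, hC⟩ := hasGlobalMinimalModel_rat_holds (freyCurve a b)
  haveI := hC
  have hNm : (C • freyCurve a b).conductorNorm ℤ = M * q := by rw [conductorNorm_smul_rat, hN]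
  have hne : Nonempty (ModularParametrizationData (C • freyCurve a b) (M * q)) :=
    (Summit.ABC.ABC.Theorems.nonempty_modularParametrizationData_smul_iff C).mpr ⟨D⟩
  obtain ⟨D₁, -, hD₁min⟩ := exists_minimal_datum hne
  obtain ⟨W₀, hW₀, D₀, hf₀, h₀⟩ := D₁.exists_optimalDatum'
  haveI := hW₀
  have hker₀ : D₀.isogenyMap.ker = ⊥ := D₀.isogenyMap_ker_eq_bot_iff.mpr h₀
  have hmin₀ : ∀ (W' : WeierstrassCurve ℚ) [W'.IsElliptic]
      (D' : ModularParametrizationData W' (M * q)), D'.f = D₀.f →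
        D₀.modularDegree ≤ D'.modularDegree := fun W' _ D' hD' =>
    D₀.modularDegree_le_of_isogenyMap_ker_eq_bot hker₀ D' hD'
  -- (T_deg) THE ONE CHANGED LINE: `deg D₁ ≤ B · deg D₀` from the Frey instance
  have h163' : D₁.modularDegree ≤ B * D₀.modularDegree :=
    hB a b hab h0 q hq hq2 hqN' (M * q) W₀ (C • freyCurve a b) D₀ D₁
      (isIsogenous_smul (freyCurve a b) C) hf₀.symm hD₁min
  obtain ⟨Ws, hWs, Ps, hNs, hfs, hPsmin⟩ :=
    Summit.ABC.ABC.Theorems.DefiniteRTControlPrime.exists_conductorMinimal D₁ hNm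
  haveI := hWs
  have h0s : D₀.modularDegree ≤ Ps.modularDegree := hmin₀ Ws Ps (hfs.trans hf₀.symm)
  have hTak : Ps.modularDegree ≤ brandtXi M q (fun n => Ws.LFunction n) *
      (Ws.minimalDiscriminantNorm ℤ).factorization q :=
    takahashi2001_thm_2_3_of_coprime.modularDegree_le_brandtXi_mul hT Ws M q hq hcop
      hNs Ps hPsmin
  have hL : (fun n => Ws.LFunction n) = fun n => (freyCurve a b).LFunction n := by
    funext n
    have h1 := Ps.isNewformOf.2 n
    have h2 := D₁.isNewformOf.2 n
    rw [hfs] at h1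
    rw [h1, LFunction_smul] at h2
    exact_mod_cast h2
  rw [hL] at hTak
  have hiso : (freyCurve a b).IsIsogenous Ws :=
    (isIsogenous_smul (freyCurve a b) C).trans'
      (Summit.ABC.ABC.Theorems.DefiniteRTControlPrime.isIsogenous_of_f_eq D₁ Ps hfs)
  have hval : (Ws.minimalDiscriminantNorm ℤ).factorization q ≤
      163 * ((freyCurve a b).minimalDiscriminantNorm ℤ).factorization q :=
    Summit.ABC.ABC.Theorems.DefiniteRTControlPrime.stub_valTransport h68 a b hab h0 q hq hq2 hqN'
      Ws hiso
  obtain ⟨D₁', -, hdeg₁'⟩ :=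
    Summit.ABC.ABC.Theorems.DefiniteRTControlPrime.stub_smulTransportDeg C D₁
  have hscale : (C.u : ℚ).num.natAbs ≤ 2 :=
    Summit.ABC.ABC.Theorems.DefiniteRTControlPrime.stub_freyScale a b hab h0 C hC
  have hD : D.deg ≤ 4 * D₁.modularDegree := by
    calc D.deg ≤ D₁'.deg := hDmin D₁'
      _ = (C.u : ℚ).num.natAbs ^ 2 * D₁.deg := hdeg₁'
      _ ≤ 2 ^ 2 * D₁.deg := Nat.mul_le_mul_right _ (Nat.pow_le_pow_left hscale 2)
      _ = 4 * D₁.modularDegree := by norm_num [ModularParametrizationData.modularDegree]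
  set ξ : ℕ := brandtXi M q (fun n => (freyCurve a b).LFunction n) with hξ
  set v : ℕ := ((freyCurve a b).minimalDiscriminantNorm ℤ).factorization q with hv
  have hchain : D.deg ≤ 4 * B * 163 * (ξ * v) :=
    calc D.deg ≤ 4 * D₁.modularDegree := hD
      _ ≤ 4 * (B * D₀.modularDegree) := Nat.mul_le_mul_left _ h163'
      _ ≤ 4 * (B * Ps.modularDegree) := Nat.mul_le_mul_left _ (Nat.mul_le_mul_left _ h0s)
      _ ≤ 4 * (B * (ξ * (Ws.minimalDiscriminantNorm ℤ).factorization q)) :=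
          Nat.mul_le_mul_left _ (Nat.mul_le_mul_left _ hTak)
      _ ≤ 4 * (B * (ξ * (163 * v))) :=
          Nat.mul_le_mul_left _ (Nat.mul_le_mul_left _ (Nat.mul_le_mul_left _ hval))
      _ = 4 * B * 163 * (ξ * v) := by ring
  have hN1 : (1 : ℝ) ≤ ((M * q : ℕ) : ℝ) := by
    exact_mod_cast Nat.one_le_iff_ne_zero.mpr (NeZero.ne (M * q))
  have hrpow : (1 : ℝ) ≤ ((M * q : ℕ) : ℝ) ^ ε := Real.one_le_rpow hN1 hε.le
  have hcast : (D.deg : ℝ) ≤ ((4 * B * 163 : ℕ) : ℝ) * ((ξ : ℝ) * (v : ℝ)) := by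
    exact_mod_cast hchain
  have hξv : (0 : ℝ) ≤ (ξ : ℝ) * (v : ℝ) := by positivity
  have hK : (0 : ℝ) ≤ ((4 * B * 163 : ℕ) : ℝ) := by positivity
  calc (D.deg : ℝ) ≤ ((4 * B * 163 : ℕ) : ℝ) * ((ξ : ℝ) * (v : ℝ)) := hcast
    _ = ((4 * B * 163 : ℕ) : ℝ) * 1 * ((ξ : ℝ) * (v : ℝ)) := by ring
    _ ≤ ((4 * B * 163 : ℕ) : ℝ) * ((M * q : ℕ) : ℝ) ^ ε * ((ξ : ℝ) * (v : ℝ)) := by gcongr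

/-- **L2′** (M; k3g4's `DefiniteRTControlPrime_of_two_facts` (`StubIdeasK3G4PastenLemma68.lean`, rc 0,
not landed) with `h163 ↦ hB` at its two call sites, constant `4·B³`): Lemma 6.8 is not needed either —
the valuation transport runs along the lattice isogenies of degree `≤ B`. Cited, not copied. -/
theorem definiteRTControlPrime_of_pastenBoundFrey' (hT : takahashi2001_thm_2_3_of_coprime) {B : ℕ}
    (hB : PastenBoundFrey B) : DefiniteRTControlPrime := by
  sorry

/-! ## §3 The Frey cyclic diameter `d ∣ 1008` from Cor. 4.4 and Klein–Fricke 13 (gen 4, `hT27` discharged) -/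

/-- **A′1a** (S): a prime dividing the degree of a CYCLIC `ℚ`-isogeny out of `W` makes `ρ̄_{W,p}`
reducible (`W[p] ∩ ker φ` is a stable line). Body: the landed `mem_mazurPrimes_of_prime_dvd_degree`
up to its use of `mazur_isogeny_irreducible`. [cite: SilvermanAEC2009, Prop. III.4.12] -/
theorem not_hasIrreducibleModPGaloisRep_of_prime_dvd_degree {W W' : WeierstrassCurve ℚ}
    [W.IsElliptic] [W'.IsElliptic] (φ : Isogeny W W') (hφ : φ.IsCyclic) {p : ℕ} (hp : p.Prime)
    (hpd : p ∣ φ.degree) : ¬ W.HasIrreducibleModPGaloisRep p := by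
  sorry

/-- **A′1c** (XS, PROVED over A′1a): at an odd MULTIPLICATIVE place Cor. 4.4 forbids every prime
`p ∉ {2,3,5,7,13}` in a cyclic degree out of `W`. [cite: Mazur1978, Cor. 4.4 (p. 145)]
[cite: SilvermanAEC2009, Prop. VII.5.1(b)] -/
theorem not_prime_dvd_degree_of_cor44 (h44 : Mazur1978.cor44_valuation_j_le_one)
    {W W' : WeierstrassCurve ℚ} [W.IsElliptic] [W'.IsElliptic] (φ : Isogeny W W')
    (hφ : φ.IsCyclic) {p : ℕ} (hp : p.Prime) (hpS : p ∉ ({2, 3, 5, 7, 13} : Finset ℕ))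
    (v : HeightOneSpectrum (𝓞 ℚ)) (hv : (2 : 𝓞 ℚ) ∉ v.asIdeal)
    (hm : W.HasMultiplicativeReductionAt v) : ¬ p ∣ φ.degree := fun hpd ↦ by
  haveI : Fact p.Prime := ⟨hp⟩
  haveI : NeZero (p : ℚ) := ⟨Nat.cast_ne_zero.mpr hp.ne_zero⟩
  exact (one_lt_valuation_j_of_hasMultiplicativeReduction_localMinimalModel v W hm).not_ge
    (h44 W p (Mazur1978.eq_eleven_or_seventeen_le_of_not_mem hp hpS)
      ((Mazur1978.not_hasIrreducibleModPGaloisRep_iff_exists_natCard_eq W p).mp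
        (not_hasIrreducibleModPGaloisRep_of_prime_dvd_degree φ hφ hp hpd)) v hv)

/-- **A′2** (S–M; RE-CUT of the landed `hasIrreducibleModPGaloisRep_of_rational_two_torsion_of_mazurKenku`,
Steps 1–4 + first line of Step 5 verbatim, then `exact hlev …` on the cyclic `4p`-isogeny).
[cite: DarmonMerel1997, Thm. 2.2 with Lemma 1.2 (1)] -/
theorem hasIrreducibleModPGaloisRep_of_rational_two_torsion_of_level (W : WeierstrassCurve ℚ)
    [W.IsElliptic] (h2 : ∀ (σ : absoluteGaloisGroup ℚ) (P : W.geomPoints), 2 • P = 0 → σ • P = P)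
    {p : ℕ} (hp : p.Prime) (hp2 : p ≠ 2)
    (hlev : ∀ (V V' : WeierstrassCurve ℚ) [V.IsElliptic] [V'.IsElliptic] (ψ : Isogeny V V'),
      ψ.IsCyclic → ψ.degree ≠ 4 * p) :
    W.HasIrreducibleModPGaloisRep p := by
  sorry

/-- A′3(5) (XS, proved): level `20`. -/
theorem isCyclic_degree_ne_four_mul_five (V V' : WeierstrassCurve ℚ) [V.IsElliptic] [V'.IsElliptic]
    (ψ : Isogeny V V') (hψ : ψ.IsCyclic) : ψ.degree ≠ 4 * 5 :=
  Summit.ABC.ABC.Theorems.isogeny_isCyclic_degree_ne_twenty_holds V V' ψ hψ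

/-- A′3(13) (XS, proved): level `52 ⊇ 26`, modulo the cite-only Klein–Fricke `13`. -/
theorem isCyclic_degree_ne_four_mul_thirteen (h13 : kleinFrickeThirteen_exists_j_eq)
    (V V' : WeierstrassCurve ℚ) [V.IsElliptic] [V'.IsElliptic] (ψ : Isogeny V V')
    (hψ : ψ.IsCyclic) : ψ.degree ≠ 4 * 13 := by
  intro h
  obtain ⟨V'', hV'', χ, hχ, hdeg, -⟩ :=
    ψ.exists_isCyclic_degree_eq_of_dvd hψ (show 26 ∣ ψ.degree by rw [h]; norm_num)
  haveI := hV''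
  exact Summit.ABC.ABC.Theorems.isCyclic_degree_ne_twentySix h13 V V'' χ hχ hdeg

/-- **gen 5: `hT27` is a THEOREM** (XS, proved): the landed level `27` (p171877). [cite: Ligozat1975] -/
theorem hT27 (V V' : WeierstrassCurve ℚ) [V.IsElliptic] [V'.IsElliptic] (ψ : Isogeny V V')
    (hψ : ψ.IsCyclic) (hdeg : ψ.degree = 27) : V.j = -12288000 :=
  ψ.j_eq_of_isCyclic_degree_twentySeven hψ hdeg

/-- **A′4ar** (S, arithmetic). [folklore] -/
theorem dvd_1008_of_primeFactors {d : ℕ} (hd : 0 < d)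
    (hsupp : ∀ p : ℕ, p.Prime → p ∣ d → p = 2 ∨ p = 3 ∨ p = 7)
    (h32 : ¬ 32 ∣ d) (h27 : ¬ 27 ∣ d) (h49 : ¬ 49 ∣ d) : d ∣ 1008 := by
  sorry

/-- **A′4** (M, the assembly): inside the class of a Frey curve with an ODD bad prime every cyclic
`ℚ`-isogeny has degree `d ∣ 1008`: primes `p ∣ d` lie in `{2,3,5,7,13}` (A′1c at the place over `q`,
multiplicative for every curve of the class: `hasMultiplicativeReductionAt_freyCurve_of_ne_two`,
`hasMultiplicativeReductionAt_of_isIsogenous`); `5, 13` excluded by A′2 + A′3 transported along the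
class (`Rank1Residual.not_hasIrreducibleModPGaloisRep_of_isIsogenous`, `smul_eq_of_two_nsmul_eq_zero_freyCurve`);
`32, 49 ∤ d` (landed levels); `27 ∤ d` by `hT27` (`j ∈ ℤ` against `ord_q j < 0`); then A′4ar.
[cite: Mazur1978, Cor. 4.4] [cite: Kenku1982, Thm. 1] [cite: Ligozat1975] -/
theorem frey_isCyclic_degree_dvd (h44 : Mazur1978.cor44_valuation_j_le_one)
    (h13 : kleinFrickeThirteen_exists_j_eq)
    {a b : ℤ} (hab : IsCoprime a b) (h0 : a * b * (a + b) ≠ 0) {q : ℕ} (hq : q.Prime)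
    (hq2 : q ≠ 2) (hqN : q ∣ (freyCurve a b).conductorNorm ℤ)
    (W₁ W₂ : WeierstrassCurve ℚ) [W₁.IsElliptic] [W₂.IsElliptic]
    (h₁ : (freyCurve a b).IsIsogenous W₁) (φ : Isogeny W₁ W₂) (hφ : φ.IsCyclic) :
    φ.degree ∣ 1008 := by
  sorry

/-- (XS, proved) the diameter `1008` from {Cor. 4.4, Klein–Fricke 13}. -/
theorem freyIsogenyDiameterOdd_of_cor44 (h44 : Mazur1978.cor44_valuation_j_le_one)
    (h13 : kleinFrickeThirteen_exists_j_eq) : FreyIsogenyDiameterOdd 1008 :=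
  fun _ _ hab h0 _ hq hq2 hqN W₁ W₂ _ _ h₁ φ hφ ↦
    Nat.le_of_dvd (by norm_num) (frey_isCyclic_degree_dvd h44 h13 hab h0 hq hq2 hqN W₁ W₂ h₁ φ hφ)

/-! ## §4 Assembled -/

/-- **Plan A′ (gen 5), assembled through the skeleton's own shape** (XS): the crux modulo
{Takahashi 2.3, Cor. 4.4, Klein–Fricke 13, Lemma 6.8}. -/
theorem definiteRTControlPrime_of_cor44 (hT : takahashi2001_thm_2_3_of_coprime)
    (h44 : Mazur1978.cor44_valuation_j_le_one) (h13 : kleinFrickeThirteen_exists_j_eq)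
    (h68 : PastenShimura2024_lemma_6_8) : DefiniteRTControlPrime :=
  definiteRTControlPrime_of_pastenBoundFrey hT
    (pastenBoundFrey_of_diameter (freyIsogenyDiameterOdd_of_cor44 h44 h13)) h68

/-- The same, Lemma-6.8-free (over L2′): the crux modulo {Takahashi 2.3, Cor. 4.4, Klein–Fricke 13}. -/
theorem definiteRTControlPrime_of_cor44' (hT : takahashi2001_thm_2_3_of_coprime)
    (h44 : Mazur1978.cor44_valuation_j_le_one) (h13 : kleinFrickeThirteen_exists_j_eq) :
    DefiniteRTControlPrime :=
  definiteRTControlPrime_of_pastenBoundFrey' hT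
    (pastenBoundFrey_of_diameter (freyIsogenyDiameterOdd_of_cor44 h44 h13))

end Summit.ABC.ABC.Cruxes.DefiniteRTControlPrime.Sketch.Ideas1g5

end
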